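import Mathlib.Algebra.BigOperators.Intervals
import Mathlib.Algebra.Polynomial.Inductions
import Mathlib.Topology.Algebra.Polynomial
import Literature.Analysis.Fourier.ChebyshevLowPassBumps
import HarnessLib

/-!
# Telescoping low-pass pieces: a polynomial partition of `1/a`

Topic `Literature/Analysis/Fourier`.  The one-variable skeleton of the finite-range decomposition with
regularity of all orders (Buchholz, J. Funct. Anal. 275 (2018), Thm 2.3/2.4; Bauerschmidt 2013, §2–§3):
for a band `B > 0`, an odd base `L ≥ 5` and a depth `N ≥ 1`, with the scales
`m_i = max(1, ⌊L^i/16⌋)`, `t_i = max(2, ⌊L^i/8⌋)` and the low-pass polynomials `G_i = lowPass B m_i t_i`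
of `ChebyshevLowPassBumps.lean`, put `J_k = Π_{i ≤ k} G_i` (`cascade`) and

  `c_k(a) = J_{k-1}(a) (1 − G_k(a))/a`  (`1 ≤ k ≤ N`),   `c_{N+1}(a) = J_N(a)/a`   (`piece`).

Then (all proved here):
* `sum_piece` — TELESCOPING: `Σ_{k=1}^{N+1} c_k(a) = 1/a` (`a ≠ 0`); `piece_nonneg` on `(0, 4B]`;
* `piecePoly`, `piece_eq_eval` — for `k ≤ N`, `c_k` is a polynomial of degree `≤ Σ_{i≤k}(m_i+t_i) − 1`,
  and `two_mul_natDegree_piecePoly_lt` : `2 (deg + 1) ≤ L^k + 1` (the RANGE budget, Buchholz p. 9: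
  "polynomials of degree at most t"); `piecePoly_eval_zero_nonneg` (`c_k(0) ≥ 0`, so the constant
  `M_k = −c_k(0)/M^d` of Thm 2.4 (iii) is `≤ 0`);
* LOWER bounds (Buchholz (2.27)): `piece_ge_of_le` — `c_k(a) ≥ L^{2k}/(2048π² B)` for `0 < a ≤ B L^{-2k}`,
  and `piece_one_ge` — `c_1(a) ≥ (1024π²)^{-1} min(L²/B, 1/a)` on `(0, 2B]`;
* scale bookkeeping: `three_mul_scaleT_le` (`t_{i}/t_{i+1} ≤ 2/3`), `sum_scaleT_sq_le`.

The derivative ("symbol") bounds for the pieces are in the companion file `TelescopingLowPassBounds.lean`.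

## References
* S. Buchholz, *Finite range decomposition for Gaussian measures with improved regularity*,
  J. Funct. Anal. 275 (2018), Thm 2.3 (2.25)–(2.27), §3 p. 9 [Buchholz2016].
* R. Bauerschmidt, *A simple method for finite range decomposition of quadratic forms and Gaussian
  fields*, Probab. Theory Relat. Fields 157 (2013), §2.1–§3 [Bauerschmidt2013].
-/

noncomputable section

open Finset Polynomial
open scoped Real

namespace Literature.Analysis.Fourier

/-! ## Scales -/

/-- The Fejér scale `m_i = max(1, ⌊L^i/16⌋)`. [cite: Bauerschmidt2013, §3.2 (choice of t)] -/
def scaleM (L i : ℕ) : ℕ := max 1 (L ^ i / 16)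

/-- The smooth-profile scale `t_i = max(2, ⌊L^i/8⌋)`. [cite: Bauerschmidt2013, §3.2 (choice of t)] -/
def scaleT (L i : ℕ) : ℕ := max 2 (L ^ i / 8)

/-- `1 ≤ m_i`. [cite: Bauerschmidt2013, §3.2] -/
theorem one_le_scaleM (L i : ℕ) : 1 ≤ scaleM L i := le_max_left _ _

/-- `2 ≤ t_i`. [cite: Bauerschmidt2013, §3.2] -/
theorem two_le_scaleT (L i : ℕ) : 2 ≤ scaleT L i := le_max_left _ _

/-- `m_i ≤ t_i`. [cite: Bauerschmidt2013, §3.2] -/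
theorem scaleM_le_scaleT (L i : ℕ) : scaleM L i ≤ scaleT L i := by
  unfold scaleM scaleT; omega

/-- `t_i ≥ L^i/16`. [cite: Bauerschmidt2013, §3.2] -/
theorem scaleT_ge (L i : ℕ) : (L : ℝ) ^ i / 16 ≤ scaleT L i := by
  unfold scaleT
  have h8 : ((L ^ i / 8 : ℕ) : ℝ) ≥ (L : ℝ) ^ i / 8 - 1 := by
    have h := Nat.lt_div_mul_add (a := L ^ i) (b := 8) (by norm_num)
    have h' : ((L ^ i : ℕ) : ℝ) < ((L ^ i / 8 : ℕ) : ℝ) * 8 + 8 := by exact_mod_cast h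
    push_cast at h'
    linarith
  rcases le_or_gt 16 (L ^ i) with h16 | h16
  · have : (16 : ℝ) ≤ (L : ℝ) ^ i := by exact_mod_cast h16
    calc (L : ℝ) ^ i / 16 ≤ (L : ℝ) ^ i / 8 - 1 := by linarith
      _ ≤ ((L ^ i / 8 : ℕ) : ℝ) := h8
      _ ≤ ((max 2 (L ^ i / 8) : ℕ) : ℝ) := by exact_mod_cast le_max_right _ _
  · have : (L : ℝ) ^ i < 16 := by exact_mod_cast h16
    calc (L : ℝ) ^ i / 16 ≤ 2 := by linarith
      _ ≤ ((max 2 (L ^ i / 8) : ℕ) : ℝ) := by exact_mod_cast le_max_left _ _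

/-- `m_i + 1 ≥ L^i/16`. [cite: Bauerschmidt2013, §3.2] -/
theorem scaleM_succ_ge (L i : ℕ) : (L : ℝ) ^ i / 16 ≤ scaleM L i + 1 := by
  unfold scaleM
  have h := Nat.lt_div_mul_add (a := L ^ i) (b := 16) (by norm_num)
  have h' : ((L ^ i : ℕ) : ℝ) < ((L ^ i / 16 : ℕ) : ℝ) * 16 + 16 := by exact_mod_cast h
  push_cast at h'
  have h2 : ((L ^ i / 16 : ℕ) : ℝ) ≤ ((max 1 (L ^ i / 16) : ℕ) : ℝ) := by exact_mod_cast le_max_right _ _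
  linarith

/-- `t_i ≤ L^i/2` for `L ≥ 2`, `i ≥ 1`. [cite: Bauerschmidt2013, §3.2] -/
theorem scaleT_le (L i : ℕ) (hL : 4 ≤ L) (hi : 1 ≤ i) : (scaleT L i : ℝ) ≤ (L : ℝ) ^ i / 2 := by
  unfold scaleT
  have h4 : 4 ≤ L ^ i := le_trans hL (Nat.le_self_pow (by omega) L)
  have h4' : (4 : ℝ) ≤ (L : ℝ) ^ i := by exact_mod_cast h4
  rcases le_or_gt (L ^ i / 8) 2 with h | h
  · rw [max_eq_left h]; push_cast; linarith
  · rw [max_eq_right h.le]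
    have : ((L ^ i / 8 : ℕ) : ℝ) ≤ (L : ℝ) ^ i / 8 := by
      have := Nat.cast_div_le (m := L ^ i) (n := 8) (α := ℝ)
      push_cast at this; exact this
    linarith

/-- The scale ratio `3 t_i ≤ 2 t_{i+1}` (`L ≥ 5`, `i ≥ 1`): consecutive scales grow by a factor `≥ 3/2`.
[cite: Bauerschmidt2013, §3.2] -/
theorem three_mul_scaleT_le (L i : ℕ) (hL : 5 ≤ L) (hi : 1 ≤ i) : 3 * scaleT L i ≤ 2 * scaleT L (i + 1) := by
  unfold scaleT
  have hmul : L * (L ^ i / 8) ≤ L ^ (i + 1) / 8 := by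
    rw [pow_succ']; exact Nat.mul_div_le_mul_div_assoc L (L ^ i) 8
  have h25 : 25 ≤ L ^ (i + 1) := by
    calc 25 = 5 ^ 2 := by norm_num
      _ ≤ L ^ 2 := Nat.pow_le_pow_left hL 2
      _ ≤ L ^ (i + 1) := Nat.pow_le_pow_right (by omega) (by omega)
  have h3 : 3 ≤ L ^ (i + 1) / 8 := by omega
  have hq : 5 * (L ^ i / 8) ≤ L ^ (i + 1) / 8 := le_trans (Nat.mul_le_mul_right _ hL) hmul
  omega

/-- **Range budget**: `2 Σ_{i=1}^k (m_i + t_i) ≤ L^k + 1` (`L ≥ 5`, `k ≥ 1`). [cite: Buchholz2016, §3 (p. 9)] -/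
theorem two_mul_sum_scales_le (L k : ℕ) (hL : 5 ≤ L) (hk : 1 ≤ k) :
    2 * ∑ i ∈ Finset.Icc 1 k, (scaleM L i + scaleT L i) ≤ L ^ k + 1 := by
  induction k with
  | zero => omega
  | succ k ih =>
    rcases Nat.eq_zero_or_pos k with hk0 | hkpos
    · subst hk0
      simp only [zero_add, Finset.Icc_self, Finset.sum_singleton]
      unfold scaleM scaleT
      simp only [pow_one]
      omega
    · rw [Finset.sum_Icc_succ_top (by omega), mul_add]
      have ih' := ih hkpos
      have hQ : 5 ≤ L ^ k := le_trans hL (by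
        calc L = L ^ 1 := (pow_one L).symm
          _ ≤ L ^ k := Nat.pow_le_pow_right (by omega) hkpos)
      have hP : L ^ (k + 1) = L * L ^ k := pow_succ' L k
      have hP5 : 5 * L ^ k ≤ L ^ (k + 1) := by rw [hP]; exact Nat.mul_le_mul_right _ hL
      have hm : scaleM L (k + 1) = max 1 (L ^ (k + 1) / 16) := rfl
      have ht : scaleT L (k + 1) = max 2 (L ^ (k + 1) / 8) := rfl
      rw [hm, ht]
      generalize L ^ (k + 1) = P at hP5 ⊢
      generalize L ^ k = Q at ih' hQ hP5 ⊢
      generalize (∑ i ∈ Finset.Icc 1 k, (scaleM L i + scaleT L i)) = S at ih' ⊢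
      omega

/-- `Σ_{i=1}^{n} L^{2i} ≤ 2 L^{2n}` (`L ≥ 2`). [cite: Bauerschmidt2013, §3.2] -/
theorem sum_pow_two_mul_le (L n : ℕ) (hL : 2 ≤ L) :
    ∑ i ∈ Finset.Icc 1 n, (L : ℝ) ^ (2 * i) ≤ 2 * (L : ℝ) ^ (2 * n) := by
  induction n with
  | zero => simp
  | succ n ih =>
    rw [Finset.sum_Icc_succ_top (by omega)]
    have hL2 : (2 : ℝ) ≤ (L : ℝ) ^ 2 := by
      have : (2 : ℝ) ≤ L := by exact_mod_cast hL
      nlinarith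
    have : (L : ℝ) ^ (2 * (n + 1)) = (L : ℝ) ^ (2 * n) * (L : ℝ) ^ 2 := by rw [← pow_add]; ring_nf
    rw [this]
    have h0 : 0 ≤ (L : ℝ) ^ (2 * n) := by positivity
    nlinarith

/-- `Σ_{i=1}^{n} t_i² ≤ L^{2n}/2` (`L ≥ 2`). [cite: Bauerschmidt2013, §3.2] -/
theorem sum_scaleT_sq_le (L n : ℕ) (hL : 4 ≤ L) :
    ∑ i ∈ Finset.Icc 1 n, (scaleT L i : ℝ) ^ 2 ≤ (L : ℝ) ^ (2 * n) / 2 := by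
  have h : ∀ i ∈ Finset.Icc 1 n, (scaleT L i : ℝ) ^ 2 ≤ (L : ℝ) ^ (2 * i) / 4 := by
    intro i hi
    rw [Finset.mem_Icc] at hi
    have h1 := scaleT_le L i hL hi.1
    have h0 : (0 : ℝ) ≤ scaleT L i := Nat.cast_nonneg _
    calc (scaleT L i : ℝ) ^ 2 ≤ ((L : ℝ) ^ i / 2) ^ 2 := pow_le_pow_left₀ h0 h1 2
      _ = (L : ℝ) ^ (2 * i) / 4 := by rw [div_pow, ← pow_mul, mul_comm]; norm_num
  calc ∑ i ∈ Finset.Icc 1 n, (scaleT L i : ℝ) ^ 2 ≤ ∑ i ∈ Finset.Icc 1 n, (L : ℝ) ^ (2 * i) / 4 := sum_le_sum h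
    _ = (∑ i ∈ Finset.Icc 1 n, (L : ℝ) ^ (2 * i)) / 4 := by rw [Finset.sum_div]
    _ ≤ 2 * (L : ℝ) ^ (2 * n) / 4 := by gcongr; exact sum_pow_two_mul_le L n (by omega)
    _ = (L : ℝ) ^ (2 * n) / 2 := by ring

/-! ## The low-pass cascade and the pieces -/

/-- The `i`-th low-pass `G_i = lowPass B m_i t_i`. [cite: Buchholz2016, Lemma 5.1 (5.2)] -/
def lp (B : ℝ) (L i : ℕ) (a : ℝ) : ℝ := lowPass B (scaleM L i) (scaleT L i) a

/-- `G_i` as a polynomial. [cite: Buchholz2016, §3 (p. 9)] -/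
def lpPoly (B : ℝ) (L i : ℕ) : ℝ[X] := lowPassPoly B (scaleM L i) (scaleT L i)

/-- The cascade `J_k = Π_{i=1}^k G_i`. [cite: Bauerschmidt2013, §2.1 (φ_t as a product)] -/
def cascade (B : ℝ) (L k : ℕ) (a : ℝ) : ℝ := ∏ i ∈ Finset.Icc 1 k, lp B L i a

/-- `J_k` as a polynomial. [cite: Buchholz2016, §3 (p. 9)] -/
def cascadePoly (B : ℝ) (L k : ℕ) : ℝ[X] := ∏ i ∈ Finset.Icc 1 k, lpPoly B L i

/-- The quotient polynomial `h_i = (1 − G_i)/X`. [cite: Buchholz2016, §3 (p. 9)] -/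
def quot (B : ℝ) (L i : ℕ) : ℝ[X] := divX (1 - lpPoly B L i)

/-- The pieces `c_k = J_{k-1} (1 − G_k)/a` (`k ≤ N`) and `c_{N+1} = J_N/a`.
[cite: Buchholz2016, Thm 2.3 (𝒞_{A,k}); Bauerschmidt2013, (1.4)–(1.6)] -/
def piece (B : ℝ) (L N k : ℕ) (a : ℝ) : ℝ :=
  if k ≤ N then cascade B L (k - 1) a * (quot B L k).eval a else cascade B L N a / a

/-- The piece polynomial `J_{k-1} · h_k` (`k ≤ N`). [cite: Buchholz2016, §3 (p. 9)] -/
def piecePoly (B : ℝ) (L k : ℕ) : ℝ[X] := cascadePoly B L (k - 1) * quot B L k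

/-- `lpPoly(a) = G(a)`. [cite: Buchholz2016, Lemma 5.1 (5.2)] -/
theorem lpPoly_eval (B : ℝ) (L i : ℕ) (a : ℝ) : (lpPoly B L i).eval a = lp B L i a :=
  lowPassPoly_eval _ _ _ _

/-- `cascadePoly(a) = J(a)`. [cite: Buchholz2016, §3 (p. 9)] -/
theorem cascadePoly_eval (B : ℝ) (L k : ℕ) (a : ℝ) : (cascadePoly B L k).eval a = cascade B L k a := by
  rw [cascadePoly, eval_prod, cascade]
  exact prod_congr rfl fun i _ => lpPoly_eval B L i a

/-- `G_i(0) = 1`. [cite: Buchholz2016, Lemma 5.1 (5.2)] -/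
theorem lp_zero (B : ℝ) (L i : ℕ) : lp B L i 0 = 1 := lowPass_zero (one_le_scaleM L i) (two_le_scaleT L i)

/-- `h_i · X = 1 − G_i` (exact division, as `G_i(0) = 1`). [cite: Buchholz2016, §3 (p. 9)] -/
theorem quot_mul_X (B : ℝ) (L i : ℕ) : quot B L i * X = 1 - lpPoly B L i := by
  have h := divX_mul_X_add (1 - lpPoly B L i)
  have h0 : (1 - lpPoly B L i).coeff 0 = 0 := by
    rw [coeff_zero_eq_eval_zero, eval_sub, eval_one, lpPoly_eval, lp_zero, sub_self]
  rw [h0, C_0, add_zero] at h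
  exact h

/-- `h_i(a) = (1 − G_i(a))/a` for `a ≠ 0`. [cite: Buchholz2016, §3 (p. 9)] -/
theorem quot_eval (B : ℝ) (L i : ℕ) {a : ℝ} (ha : a ≠ 0) : (quot B L i).eval a = (1 - lp B L i a) / a := by
  have h := congrArg (eval a) (quot_mul_X B L i)
  simp only [eval_mul, eval_X, eval_sub, eval_one, lpPoly_eval] at h
  rw [eq_div_iff ha, h]

/-- `h_i(a) · a = 1 − G_i(a)` for all `a`. [cite: Buchholz2016, §3 (p. 9)] -/
theorem quot_eval_mul (B : ℝ) (L i : ℕ) (a : ℝ) : (quot B L i).eval a * a = 1 - lp B L i a := by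
  have h := congrArg (eval a) (quot_mul_X B L i)
  simp only [eval_mul, eval_X, eval_sub, eval_one, lpPoly_eval] at h
  exact h

/-- For `k ≤ N` the piece is the piece polynomial. [cite: Buchholz2016, §3 (p. 9)] -/
theorem piece_eq_eval {B : ℝ} {L N k : ℕ} (hk : k ≤ N) (a : ℝ) : piece B L N k a = (piecePoly B L k).eval a := by
  rw [piece, if_pos hk, piecePoly, eval_mul, cascadePoly_eval]

/-- The last piece `c_{N+1} = J_N/a`. [cite: Buchholz2016, Thm 2.3] -/
theorem piece_last (B : ℝ) (L N : ℕ) (a : ℝ) : piece B L N (N + 1) a = cascade B L N a / a := by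
  rw [piece, if_neg (by omega)]

/-- `J_0 = 1`. [cite: Bauerschmidt2013, §2.1] -/
theorem cascade_zero (B : ℝ) (L : ℕ) (a : ℝ) : cascade B L 0 a = 1 := by
  simp [cascade]

/-- `J_{k+1} = J_k G_{k+1}`. [cite: Bauerschmidt2013, §2.1] -/
theorem cascade_succ (B : ℝ) (L k : ℕ) (a : ℝ) : cascade B L (k + 1) a = cascade B L k a * lp B L (k + 1) a := by
  rw [cascade, cascade, Finset.prod_Icc_succ_top (by omega)]

/-- For `k ≤ N`, `k ≥ 1`: `c_k(a) · a = J_{k-1}(a) − J_k(a)`. [cite: Bauerschmidt2013, (1.6)] -/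
theorem piece_mul_eq {B : ℝ} {L N k : ℕ} (hk : k ≤ N) (hk1 : 1 ≤ k) (a : ℝ) :
    piece B L N k a * a = cascade B L (k - 1) a - cascade B L k a := by
  rw [piece, if_pos hk, mul_assoc, quot_eval_mul]
  obtain ⟨j, rfl⟩ : ∃ j, k = j + 1 := ⟨k - 1, by omega⟩
  rw [Nat.add_sub_cancel, cascade_succ]
  ring

/-- **Telescoping**: `Σ_{k=1}^{N+1} c_k(a) = 1/a` for `a ≠ 0`. [cite: Bauerschmidt2013, (1.4)–(1.6)] -/
theorem sum_piece (B : ℝ) (L N : ℕ) {a : ℝ} (ha : a ≠ 0) : ∑ k ∈ Finset.Icc 1 (N + 1), piece B L N k a = 1 / a := by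
  rw [eq_div_iff ha, Finset.sum_mul, Finset.sum_Icc_succ_top (by omega), piece_last, div_mul_cancel₀ _ ha]
  have htel : ∑ k ∈ Finset.Icc 1 N, piece B L N k a * a = 1 - cascade B L N a := by
    have h1 : ∑ k ∈ Finset.Icc 1 N, piece B L N k a * a =
        ∑ k ∈ Finset.Icc 1 N, (cascade B L (k - 1) a - cascade B L k a) :=
      sum_congr rfl fun k hk => by
        rw [Finset.mem_Icc] at hk
        exact piece_mul_eq hk.2 hk.1 a
    rw [h1, ← Finset.Ico_add_one_right_eq_Icc, Finset.sum_Ico_eq_sum_range, Nat.add_sub_cancel]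
    have h2 : ∑ k ∈ Finset.range N, (cascade B L (1 + k - 1) a - cascade B L (1 + k) a) =
        ∑ k ∈ Finset.range N, (cascade B L k a - cascade B L (k + 1) a) :=
      sum_congr rfl fun k _ => by rw [show 1 + k - 1 = k by omega, add_comm]
    rw [h2, Finset.sum_range_sub', cascade_zero]
  rw [htel]; ring

/-! ## Values in `[0,1]`, nonnegativity -/

/-- `0 ≤ G_i(a) ≤ 1` on `[0, 4B]`. [cite: Buchholz2016, Lemma 5.1 (5.2)] -/
theorem lp_mem_Icc {B : ℝ} (hB : 0 < B) (L i : ℕ) {a : ℝ} (ha0 : 0 ≤ a) (ha : a ≤ 4 * B) :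
    lp B L i a ∈ Set.Icc (0 : ℝ) 1 :=
  ⟨lowPass_nonneg hB _ _ ha0 ha, lowPass_le_one hB _ _ ha0 ha⟩

/-- `0 ≤ J_k(a) ≤ 1` on `[0, 4B]`. [cite: Bauerschmidt2013, §2.1] -/
theorem cascade_mem_Icc {B : ℝ} (hB : 0 < B) (L k : ℕ) {a : ℝ} (ha0 : 0 ≤ a) (ha : a ≤ 4 * B) :
    cascade B L k a ∈ Set.Icc (0 : ℝ) 1 := by
  induction k with
  | zero => rw [cascade_zero]; exact ⟨zero_le_one, le_rfl⟩
  | succ k ih =>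
    rw [cascade_succ]
    have hG := lp_mem_Icc hB L (k + 1) ha0 ha
    exact ⟨mul_nonneg ih.1 hG.1, mul_le_one₀ ih.2 hG.1 hG.2⟩

/-- **Nonnegativity** `c_k(a) ≥ 0` on `(0, 4B]`. [cite: Buchholz2016, Thm 2.3 (positivity)] -/
theorem piece_nonneg {B : ℝ} (hB : 0 < B) (L N k : ℕ) {a : ℝ} (ha0 : 0 < a) (ha : a ≤ 4 * B) :
    0 ≤ piece B L N k a := by
  unfold piece
  split_ifs with hk
  · rw [quot_eval B L k ha0.ne']
    exact mul_nonneg (cascade_mem_Icc hB L _ ha0.le ha).1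
      (div_nonneg (by linarith [(lp_mem_Icc hB L k ha0.le ha).2]) ha0.le)
  · exact div_nonneg (cascade_mem_Icc hB L N ha0.le ha).1 ha0.le

/-! ## Degrees and the value at `0` -/

/-- `deg J_k ≤ Σ_{i≤k} (m_i + t_i)`. [cite: Buchholz2016, §3 (p. 9)] -/
theorem natDegree_cascadePoly_le (B : ℝ) (L k : ℕ) :
    (cascadePoly B L k).natDegree ≤ ∑ i ∈ Finset.Icc 1 k, (scaleM L i + scaleT L i) := by
  rw [cascadePoly]
  refine (Polynomial.natDegree_prod_le _ _).trans (sum_le_sum fun i _ => ?_)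
  exact natDegree_lowPassPoly_le _ _ _

/-- `deg h_i ≤ m_i + t_i − 1`. [cite: Buchholz2016, §3 (p. 9)] -/
theorem natDegree_quot_le (B : ℝ) (L i : ℕ) : (quot B L i).natDegree ≤ scaleM L i + scaleT L i - 1 := by
  rw [quot, natDegree_divX_eq_natDegree_tsub_one]
  refine Nat.sub_le_sub_right ?_ 1
  refine (Polynomial.natDegree_sub_le _ _).trans ?_
  rw [natDegree_one, Nat.zero_max]
  exact natDegree_lowPassPoly_le _ _ _

/-- `deg c_k ≤ Σ_{i≤k}(m_i+t_i) − 1` (`k ≥ 1`). [cite: Buchholz2016, §3 (p. 9)] -/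
theorem natDegree_piecePoly_le (B : ℝ) (L k : ℕ) (hk : 1 ≤ k) :
    (piecePoly B L k).natDegree ≤ ∑ i ∈ Finset.Icc 1 k, (scaleM L i + scaleT L i) - 1 := by
  rw [piecePoly]
  refine Polynomial.natDegree_mul_le.trans ?_
  have h1 := natDegree_cascadePoly_le B L (k - 1)
  have h2 := natDegree_quot_le B L k
  obtain ⟨j, rfl⟩ : ∃ j, k = j + 1 := ⟨k - 1, by omega⟩
  simp only [Nat.add_sub_cancel] at h1 ⊢
  rw [Finset.sum_Icc_succ_top (by omega)]
  have h3 : 3 ≤ scaleM L (j + 1) + scaleT L (j + 1) := by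
    have := one_le_scaleM L (j + 1); have := two_le_scaleT L (j + 1); omega
  omega

/-- **Range budget for the pieces**: `2 (deg c_k + 1) ≤ L^k + 1`, so `deg c_k < |x|_∞` whenever
`|x|_∞ ≥ L^k/2` (`L ≥ 5` odd, `k ≥ 1`). [cite: Buchholz2016, Thm 2.4 (iii) and §3 (p. 9)] -/
theorem two_mul_natDegree_piecePoly_lt (B : ℝ) (L k : ℕ) (hL : 5 ≤ L) (hk : 1 ≤ k) :
    2 * ((piecePoly B L k).natDegree + 1) ≤ L ^ k + 1 := by
  have h1 := natDegree_piecePoly_le B L k hk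
  have h2 := two_mul_sum_scales_le L k hL hk
  have h3 : 3 ≤ ∑ i ∈ Finset.Icc 1 k, (scaleM L i + scaleT L i) := by
    calc 3 ≤ scaleM L k + scaleT L k := by
          have := one_le_scaleM L k; have := two_le_scaleT L k; omega
      _ ≤ ∑ i ∈ Finset.Icc 1 k, (scaleM L i + scaleT L i) :=
          Finset.single_le_sum (f := fun i => scaleM L i + scaleT L i) (fun i _ => Nat.zero_le _)
            (Finset.mem_Icc.2 ⟨hk, le_rfl⟩)
  omega

/-- `c_k(0) ≥ 0` for `k ≤ N` (the limit of nonnegative values). [cite: Buchholz2016, Thm 2.4 (iii) (M_k ≤ 0)] -/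
theorem piecePoly_eval_zero_nonneg {B : ℝ} (hB : 0 < B) (L : ℕ) {N k : ℕ} (hk : k ≤ N) :
    0 ≤ (piecePoly B L k).eval 0 := by
  have hcont : Filter.Tendsto (fun a => (piecePoly B L k).eval a) (nhdsWithin 0 (Set.Ioi 0))
      (nhds ((piecePoly B L k).eval 0)) :=
    ((piecePoly B L k).continuous.tendsto 0).mono_left nhdsWithin_le_nhds
  refine ge_of_tendsto hcont ?_
  have hmem : Set.Ioo (0 : ℝ) (4 * B) ∈ nhdsWithin (0 : ℝ) (Set.Ioi 0) :=
    Ioo_mem_nhdsGT (by positivity)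
  filter_upwards [hmem] with a ha
  rw [← piece_eq_eval hk]
  exact piece_nonneg hB L N k ha.1 ha.2.le

/-! ## Lower bounds -/

/-- `1 − G_i(a) ≤ t_i² π² a/(4B)` on `[0, 2B]`. [cite: Buchholz2016, Lemma 5.1 (5.4)] -/
theorem one_sub_lp_le {B : ℝ} (hB : 0 < B) (L i : ℕ) {a : ℝ} (ha0 : 0 ≤ a) (ha : a ≤ 2 * B) :
    1 - lp B L i a ≤ (scaleT L i : ℝ) ^ 2 * π ^ 2 * a / (4 * B) := by
  have h := one_sub_lowPass_le hB (one_le_scaleM L i) (two_le_scaleT L i) ha0 ha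
  have hmt : (scaleM L i : ℝ) ≤ scaleT L i := by exact_mod_cast scaleM_le_scaleT L i
  have hm0 : (0 : ℝ) ≤ scaleM L i := Nat.cast_nonneg _
  have hsq : (scaleM L i : ℝ) ^ 2 ≤ (scaleT L i : ℝ) ^ 2 := pow_le_pow_left₀ hm0 hmt 2
  refine h.trans ?_
  rw [div_le_div_iff₀ (by positivity) (by positivity)]
  have : 0 ≤ π ^ 2 * a * (4 * B) := by positivity
  nlinarith

/-- `J_k(a) ≥ 1 − Σ_{i≤k} (1 − G_i(a))` on `[0, 4B]`. [cite: Bauerschmidt2013, §3.2] -/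
theorem cascade_ge_one_sub_sum {B : ℝ} (hB : 0 < B) (L k : ℕ) {a : ℝ} (ha0 : 0 ≤ a) (ha : a ≤ 4 * B) :
    1 - ∑ i ∈ Finset.Icc 1 k, (1 - lp B L i a) ≤ cascade B L k a := by
  induction k with
  | zero => simp [cascade_zero]
  | succ k ih =>
    rw [cascade_succ, Finset.sum_Icc_succ_top (by omega)]
    have hJ := cascade_mem_Icc hB L k ha0 ha
    have hG := lp_mem_Icc hB L (k + 1) ha0 ha
    nlinarith [hJ.1, hJ.2, hG.1, hG.2]

/-- **The cascade is flat at the next scale**: `J_{k-1}(a) ≥ 1/2` for `0 ≤ a ≤ B L^{-2k}` (`L ≥ 5`).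
[cite: Buchholz2016, Thm 2.3 (2.27) (proof, App. A)] -/
theorem cascade_ge_half {B : ℝ} (hB : 0 < B) {L : ℕ} (hL : 5 ≤ L) (k : ℕ) {a : ℝ} (ha0 : 0 ≤ a)
    (ha : a ≤ B / (L : ℝ) ^ (2 * k)) : 1 / 2 ≤ cascade B L (k - 1) a := by
  have hL1 : (1 : ℝ) ≤ L := by exact_mod_cast (show 1 ≤ L by omega)
  have hLk : (1 : ℝ) ≤ (L : ℝ) ^ (2 * k) := one_le_pow₀ hL1
  have ha2 : a ≤ 2 * B := by
    have : B / (L : ℝ) ^ (2 * k) ≤ B := div_le_self hB.le hLk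
    linarith
  have ha4 : a ≤ 4 * B := by linarith
  refine le_trans ?_ (cascade_ge_one_sub_sum hB L (k - 1) ha0 ha4)
  rcases Nat.eq_zero_or_pos k with hk | hk
  · subst hk; simp only [Nat.zero_sub, Finset.Icc_eq_empty_of_lt Nat.one_pos, Finset.sum_empty]; norm_num
  have hsum : ∑ i ∈ Finset.Icc 1 (k - 1), (1 - lp B L i a) ≤ π ^ 2 / 200 := by
    calc ∑ i ∈ Finset.Icc 1 (k - 1), (1 - lp B L i a)
        ≤ ∑ i ∈ Finset.Icc 1 (k - 1), (scaleT L i : ℝ) ^ 2 * π ^ 2 * a / (4 * B) :=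
          sum_le_sum fun i _ => one_sub_lp_le hB L i ha0 ha2
      _ = (∑ i ∈ Finset.Icc 1 (k - 1), (scaleT L i : ℝ) ^ 2) * (π ^ 2 * a / (4 * B)) := by
          rw [Finset.sum_mul]; exact sum_congr rfl fun i _ => by ring
      _ ≤ (L : ℝ) ^ (2 * (k - 1)) / 2 * (π ^ 2 * a / (4 * B)) :=
          mul_le_mul_of_nonneg_right (sum_scaleT_sq_le L (k - 1) (by omega)) (by positivity)
      _ ≤ (L : ℝ) ^ (2 * (k - 1)) / 2 * (π ^ 2 * (B / (L : ℝ) ^ (2 * k)) / (4 * B)) := by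
          gcongr
      _ = π ^ 2 / 8 * ((L : ℝ) ^ (2 * (k - 1)) / (L : ℝ) ^ (2 * k)) := by
          field_simp
          ring
      _ ≤ π ^ 2 / 8 * (1 / 25) := by
          refine mul_le_mul_of_nonneg_left ?_ (by positivity)
          rw [div_le_div_iff₀ (by positivity) (by norm_num), one_mul]
          have : (L : ℝ) ^ (2 * k) = (L : ℝ) ^ (2 * (k - 1)) * (L : ℝ) ^ 2 := by
            rw [← pow_add]; congr 1; omega
          rw [this]
          have hL5 : (25 : ℝ) ≤ (L : ℝ) ^ 2 := by
            have : (5 : ℝ) ≤ L := by exact_mod_cast hL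
            nlinarith
          have h0 : 0 ≤ (L : ℝ) ^ (2 * (k - 1)) := by positivity
          nlinarith
      _ = π ^ 2 / 200 := by ring
  have hπ : π ^ 2 / 200 ≤ 1 / 2 := by
    have := Real.pi_lt_four
    have : π ^ 2 < 16 := by nlinarith [Real.pi_pos]
    linarith
  linarith

/-- **Lower bound at scale `k`**: `c_k(a) ≥ L^{2k}/(2048 π² B)` for `0 < a ≤ B L^{-2k}`, `1 ≤ k ≤ N`, `L ≥ 5`.
[cite: Buchholz2016, Thm 2.3 (2.27)] -/
theorem piece_ge_of_le {B : ℝ} (hB : 0 < B) {L N k : ℕ} (hL : 5 ≤ L) (hk : k ≤ N) {a : ℝ}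
    (ha0 : 0 < a) (ha : a ≤ B / (L : ℝ) ^ (2 * k)) :
    (L : ℝ) ^ (2 * k) / (2048 * π ^ 2 * B) ≤ piece B L N k a := by
  have hL1 : (1 : ℝ) ≤ L := by exact_mod_cast (show 1 ≤ L by omega)
  have hLk : (1 : ℝ) ≤ (L : ℝ) ^ (2 * k) := one_le_pow₀ hL1
  have hLk0 : (0 : ℝ) < (L : ℝ) ^ (2 * k) := by positivity
  have ha2 : a ≤ 2 * B := by
    have : B / (L : ℝ) ^ (2 * k) ≤ B := div_le_self hB.le hLk
    linarith
  rw [piece, if_pos hk, quot_eval B L k ha0.ne']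
  have hJ := cascade_ge_half hB hL k ha0.le ha
  have hlow := one_sub_lowPass_ge hB (one_le_scaleM L k) (scaleT L k) ha0 ha2
  have hm : (L : ℝ) ^ k / 16 ≤ (scaleM L k : ℝ) + 1 := scaleM_succ_ge L k
  -- compare the minimum with `L^{2k} a/(1024 π² B)`
  have hmin : (L : ℝ) ^ (2 * k) * a / (1024 * π ^ 2 * B) ≤
      min (((scaleM L k : ℝ) + 1) ^ 2 * a / (4 * π ^ 2 * B)) (2 / 5) := by
    refine le_min ?_ ?_
    · rw [div_le_div_iff₀ (by positivity) (by positivity)]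
      have h1 : ((L : ℝ) ^ k / 16) ^ 2 ≤ ((scaleM L k : ℝ) + 1) ^ 2 := pow_le_pow_left₀ (by positivity) hm 2
      have h2 : ((L : ℝ) ^ k / 16) ^ 2 = (L : ℝ) ^ (2 * k) / 256 := by rw [div_pow, ← pow_mul, mul_comm]; norm_num
      rw [h2] at h1
      have h3 : 0 ≤ a * (4 * π ^ 2 * B) := by positivity
      nlinarith
    · rw [div_le_iff₀ (by positivity)]
      have : (L : ℝ) ^ (2 * k) * a ≤ B := by rwa [le_div_iff₀ hLk0, mul_comm] at ha
      have h9 : (9 : ℝ) ≤ π ^ 2 := by nlinarith [Real.pi_gt_three, Real.pi_pos]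
      have hB9 : 9 * B ≤ π ^ 2 * B := mul_le_mul_of_nonneg_right h9 hB.le
      linarith
  have h1G : 0 ≤ 1 - lp B L k a := by
    have := (lp_mem_Icc hB L k ha0.le (by linarith)).2; linarith
  calc (L : ℝ) ^ (2 * k) / (2048 * π ^ 2 * B) = 1 / 2 * (((L : ℝ) ^ (2 * k) * a / (1024 * π ^ 2 * B)) / a) := by
        field_simp; ring
    _ ≤ cascade B L (k - 1) a * ((1 - lp B L k a) / a) := by
        refine mul_le_mul hJ (div_le_div_of_nonneg_right (hmin.trans hlow) ha0.le) (by positivity)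
          ((cascade_mem_Icc hB L _ ha0.le (by linarith)).1)

/-- **Global lower bound for the first piece**: `c_1(a) ≥ (1024π²)^{-1} min(L²/B, 1/a)` on `(0, 2B]`
(`N ≥ 1`). [cite: Buchholz2016, Thm 2.3 (2.27) (k = 1)] -/
theorem piece_one_ge {B : ℝ} (hB : 0 < B) {L N : ℕ} (hN : 1 ≤ N) {a : ℝ} (ha0 : 0 < a) (ha : a ≤ 2 * B) :
    1 / (1024 * π ^ 2) * min ((L : ℝ) ^ 2 / B) (1 / a) ≤ piece B L N 1 a := by
  rw [piece, if_pos hN, quot_eval B L 1 ha0.ne', Nat.sub_self, cascade_zero, one_mul]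
  have hlow := one_sub_lowPass_ge hB (one_le_scaleM L 1) (scaleT L 1) ha0 ha
  have hm : (L : ℝ) ^ 1 / 16 ≤ (scaleM L 1 : ℝ) + 1 := scaleM_succ_ge L 1
  rw [pow_one] at hm
  rw [le_div_iff₀ ha0]
  refine le_trans ?_ hlow
  -- `(1024π²)^{-1} min(L²/B, 1/a) · a ≤ min((m+1)² a/(4π²B), 2/5)`
  rcases le_total ((L : ℝ) ^ 2 / B) (1 / a) with h | h
  · rw [min_eq_left h]
    refine le_min ?_ ?_
    · rw [show 1 / (1024 * π ^ 2) * ((L : ℝ) ^ 2 / B) * a = (L : ℝ) ^ 2 * a / (1024 * π ^ 2 * B) by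
        field_simp, div_le_div_iff₀ (by positivity) (by positivity)]
      have h1 : ((L : ℝ) / 16) ^ 2 ≤ ((scaleM L 1 : ℝ) + 1) ^ 2 := pow_le_pow_left₀ (by positivity) hm 2
      have h3 : 0 ≤ a * (4 * π ^ 2 * B) := by positivity
      nlinarith
    · have : (L : ℝ) ^ 2 / B * a ≤ 1 := by
        have := mul_le_mul_of_nonneg_right h ha0.le
        rwa [one_div, inv_mul_cancel₀ ha0.ne'] at this
      have hπ : 1 / (1024 * π ^ 2) ≤ 2 / 5 := by
        rw [div_le_div_iff₀ (by positivity) (by norm_num)]; nlinarith [Real.pi_gt_three]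
      calc 1 / (1024 * π ^ 2) * ((L : ℝ) ^ 2 / B) * a = 1 / (1024 * π ^ 2) * ((L : ℝ) ^ 2 / B * a) := by ring
        _ ≤ 1 / (1024 * π ^ 2) * 1 := mul_le_mul_of_nonneg_left this (by positivity)
        _ ≤ 2 / 5 := by linarith
  · rw [min_eq_right h]
    refine le_min ?_ ?_
    · -- `(1024π²)^{-1} ≤ (m+1)² a /(4π² B)` from `1/a ≤ L²/B`
      have hLa : B ≤ (L : ℝ) ^ 2 * a := by
        have := h
        rw [div_le_div_iff₀ ha0 hB, one_mul] at this
        linarith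
      rw [show 1 / (1024 * π ^ 2) * (1 / a) * a = 1 / (1024 * π ^ 2) by field_simp,
        div_le_div_iff₀ (by positivity) (by positivity)]
      have h1 : ((L : ℝ) / 16) ^ 2 ≤ ((scaleM L 1 : ℝ) + 1) ^ 2 := pow_le_pow_left₀ (by positivity) hm 2
      have h3 : 0 ≤ a := ha0.le
      nlinarith [mul_le_mul_of_nonneg_right h1 h3, Real.pi_pos]
    · rw [show 1 / (1024 * π ^ 2) * (1 / a) * a = 1 / (1024 * π ^ 2) by field_simp,
        div_le_div_iff₀ (by positivity) (by norm_num)]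
      nlinarith [Real.pi_gt_three]

end Literature.Analysis.Fourier

end
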